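import Mathlib
import HarnessLib
import Summits.CriticalPhenomena.CardyFormulaZ2.Theses.CardySelfRefinement
import Literature.Probability.RandomPlanarGeometry.ChordalReversibility
import Literature.Probability.RandomPlanarGeometry.ConformalRectangle
import Literature.Probability.RandomPlanarGeometry.IsometryCovariance

/-!
# Touch-probability bounds pass from the lattice to the limit family (portmanteau reduction)

Helper file for stub `stub_touchExponent` (S3 · FL2) of line `SketchIdeatorTwo` of crux
`SymmetryUpgradeR` (stmt-CriticalPhenomena-17239, route CardySelfRefinement).

The stub asks, for the scaling limit `P` of clause (iv) in the unit disc, two-sided bounds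
`c ε^{1/3} ≤ P 𝔻 {γ | γ comes ε-close to z} ≤ C ε^{1/3}` at a smooth boundary point `z`. This file
proves the **reduction to the lattice**: if along the mesh filter the bond-`ℤ²` interfaces
`bondInterfaceIn D (E δ)` of an admissible discretisation family satisfy the same two-sided bound
(any exponent `α`, any point `z`, any Dobrushin domain `D`), then so does the limit law `P D` —
with the SAME constants. The two halves are the two halves of the portmanteau theorem
(Billingsley, *Convergence of probability measures*, 2nd ed., Thm. 2.1):

* the event `U_ε = {γ | ∃ w ∈ range γ, dist w z < ε}` is OPEN in `CurveClass ℂ` (its complement is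
  `rangeSubset` of the closed set `{w | ε ≤ dist w z}`, closed by
  `CurveClass.isClosed_rangeSubset`), so `P D (U_ε) ≤ liminf_n P_n(U_ε) ≤ C ε^α`;
* the event `F_{ε'} = {γ | ∃ w ∈ range γ, dist w z ≤ ε'}` is CLOSED (its complement is
  `rangeSubset` of an open set, open by `isOpen_rangeSubset` below: traces are compact and
  upper semicontinuous in the Hausdorff sense), and `U_{ε'} ⊆ F_{ε'} ⊆ U_ε` for `ε' < ε`, so
  `P D (U_ε) ≥ limsup_n P_n(F_{ε'}) ≥ c ε'^α`; letting `ε' ↑ ε` gives `c ε^α` (continuity of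
  `rpow` at `ε > 0`), with no loss in the constant.

Contents: `stub_touchExponent_isOpen_rangeSubset`, `stub_touchExponent_isOpen_near`,
`stub_touchExponent_isClosed_nearLe` (topology of the events), `stub_touchExponent_portmanteau`
(the transfer for an arbitrary sequence of `CurveClass ℂ`-valued random variables converging in
law), and the registered helper `stub_touchExponent_ofLatticeBounds` (the transfer along clause
(iv) for `bondInterfaceIn D (E δ)`, any `ZdDiscretisationFamily D E`).

What remains for the stub itself is the lattice input at `α = 1/3` (the half-plane one-arm
exponent of bond-`ℤ²`, up to constants, uniformly in the mesh: Ikhlef–Ponsaing 2012 Prop. 4.7/4.9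
in the diagonal strip + RSW quasi-multiplicativity + an orientation transfer), not proved here.
-/

noncomputable section

namespace Summit.CriticalPhenomena.CardyFormulaZ2.Theorems.SymmetryUpgradeR.SwallowingSkeleton

open MeasureTheory Filter Set
open Literature.Probability.RandomPlanarGeometry Literature.Probability.LatticeModels
  Literature.Probability.Percolation
open UpperHalfPlane (upperHalfPlaneSet)
open scoped Topology ENNReal

/-! ### Topology of the range-neighbourhood events -/

/-- Staying inside an OPEN set is an open event of `CurveClass E`: the trace of a class is compact,
so it keeps a positive distance `r` from the complement, and every class at reparametrisation
distance `< r` has its trace in the `r`-thickening (Aizenman–Burchard 1999, §2.1; companion of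
`CurveClass.isClosed_rangeSubset`). -/
theorem stub_touchExponent_isOpen_rangeSubset {E : Type*} [MetricSpace E] {S : Set E}
    (hS : IsOpen S) : IsOpen (CurveClass.rangeSubset S) := by
  rw [Metric.isOpen_iff]
  intro c hc
  rw [CurveClass.mem_rangeSubset] at hc
  obtain ⟨r, hr, hrS⟩ := (CurveClass.isCompact_range c).exists_thickening_subset_open hS hc
  refine ⟨r, hr, fun c' hc' ↦ ?_⟩
  obtain ⟨γ, rfl⟩ := CurveClass.surjective_mk c
  obtain ⟨γ', rfl⟩ := CurveClass.surjective_mk c'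
  rw [Metric.mem_ball, CurveClass.dist_mk_mk] at hc'
  rw [CurveClass.mk_mem_rangeSubset]
  intro t
  apply hrS
  rw [CurveClass.range_mk, Metric.mem_thickening_iff_infDist_lt γ.range_nonempty]
  exact (Curve.infDist_range_le γ' γ t).trans_lt hc'

/-- The event "the curve comes within distance `< ε` of `z`" is open in `CurveClass E`. -/
theorem stub_touchExponent_isOpen_near {E : Type*} [MetricSpace E] (z : E) (ε : ℝ) :
    IsOpen {γ : CurveClass E | ∃ w ∈ γ.range, dist w z < ε} := by
  have h : {γ : CurveClass E | ∃ w ∈ γ.range, dist w z < ε} =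
      (CurveClass.rangeSubset {w | ε ≤ dist w z})ᶜ := by
    ext γ
    simp only [mem_setOf_eq, mem_compl_iff, CurveClass.mem_rangeSubset, subset_def, not_forall,
      not_le, exists_prop]
  rw [h, isOpen_compl_iff]
  exact CurveClass.isClosed_rangeSubset (isClosed_le continuous_const (continuous_id.dist
    continuous_const))

/-- The event "the curve comes within distance `≤ ε` of `z`" is closed in `CurveClass E`. -/
theorem stub_touchExponent_isClosed_nearLe {E : Type*} [MetricSpace E] (z : E) (ε : ℝ) :
    IsClosed {γ : CurveClass E | ∃ w ∈ γ.range, dist w z ≤ ε} := by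
  have h : {γ : CurveClass E | ∃ w ∈ γ.range, dist w z ≤ ε} =
      (CurveClass.rangeSubset {w | ε < dist w z})ᶜ := by
    ext γ
    simp only [mem_setOf_eq, mem_compl_iff, CurveClass.mem_rangeSubset, subset_def, not_forall,
      not_lt, exists_prop]
  rw [h, isClosed_compl_iff]
  exact stub_touchExponent_isOpen_rangeSubset (isOpen_lt continuous_const (continuous_id.dist
    continuous_const))

/-! ### The portmanteau transfer -/

/-- **Two-sided touch bounds pass to the weak limit.** Let `X n : Ω → CurveClass ℂ` be (eventually
a.e.-measurable) random curves under a probability measure `μ` converging in law to the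
probability measure `ν` (`∫ f (X n) dμ → ∫ f dν` for bounded continuous `f`). If for every
`ε ∈ (0, ε₀)`, eventually in `n`, `c ε^α ≤ μ[X n comes ε-close to z] ≤ C ε^α`, then
`c ε^α ≤ ν[γ comes ε-close to z] ≤ C ε^α` for every `ε ∈ (0, ε₀)` (portmanteau for the open event
and for the closed events `{dist ≤ ε'}`, `ε' ↑ ε`; Billingsley 1999, Thm. 2.1). -/
theorem stub_touchExponent_portmanteau {Ω : Type*} [MeasurableSpace Ω] (μ : Measure Ω)
    [IsProbabilityMeasure μ] (ν : Measure (CurveClass ℂ)) [IsProbabilityMeasure ν]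
    (X : ℕ → Ω → CurveClass ℂ) (hX : ∀ᶠ n in atTop, AEMeasurable (X n) μ)
    (hconv : ∀ f : BoundedContinuousFunction (CurveClass ℂ) ℝ,
      Tendsto (fun n => ∫ ω, f (X n ω) ∂μ) atTop (𝓝 (∫ γ, f γ ∂ν)))
    (z : ℂ) (α c C ε₀ : ℝ)
    (hlatt : ∀ ε ∈ Set.Ioo 0 ε₀, ∀ᶠ n in atTop,
      c * ε ^ α ≤ μ.real {ω | ∃ w ∈ (X n ω).range, dist w z < ε} ∧
        μ.real {ω | ∃ w ∈ (X n ω).range, dist w z < ε} ≤ C * ε ^ α) :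
    ∀ ε ∈ Set.Ioo 0 ε₀, c * ε ^ α ≤ ν.real {γ | ∃ w ∈ γ.range, dist w z < ε} ∧
      ν.real {γ | ∃ w ∈ γ.range, dist w z < ε} ≤ C * ε ^ α := by
  classical
  intro ε hε
  -- the laws of the `X n`, as probability measures (junk `ν` where `X n` is not a.e.-measurable)
  set νP : ProbabilityMeasure (CurveClass ℂ) := ⟨ν, inferInstance⟩ with hνP
  let P : ℕ → ProbabilityMeasure (CurveClass ℂ) := fun n =>
    if h : AEMeasurable (X n) μ then ⟨μ.map (X n), Measure.isProbabilityMeasure_map h⟩ else νP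
  have hP : ∀ n, AEMeasurable (X n) μ → (P n : Measure (CurveClass ℂ)) = μ.map (X n) := by
    intro n h
    simp only [P, dif_pos h]
    rfl
  have htend : Tendsto P atTop (𝓝 νP) := by
    rw [ProbabilityMeasure.tendsto_iff_forall_integral_tendsto]
    intro f
    refine (hconv f).congr' ?_
    filter_upwards [hX] with n hn
    rw [hP n hn, integral_map hn f.continuous.aestronglyMeasurable]
  have hPS : ∀ {S : Set (CurveClass ℂ)}, MeasurableSet S →
      ∀ᶠ n in atTop, (P n : Measure (CurveClass ℂ)) S = μ {ω | X n ω ∈ S} := by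
    intro S hS
    filter_upwards [hX] with n hn
    rw [hP n hn, Measure.map_apply_of_aemeasurable hn hS]
    rfl
  set U : Set (CurveClass ℂ) := {γ | ∃ w ∈ γ.range, dist w z < ε} with hU
  have hUo : IsOpen U := stub_touchExponent_isOpen_near z ε
  constructor
  · -- lower bound: closed events `F_{ε'}`, `ε' ↑ ε`
    have key : ∀ ε' ∈ Set.Ioo 0 ε, c * ε' ^ α ≤ ν.real U := by
      intro ε' hε'
      set F : Set (CurveClass ℂ) := {γ | ∃ w ∈ γ.range, dist w z ≤ ε'} with hF
      have hFc : IsClosed F := stub_touchExponent_isClosed_nearLe z ε'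
      have hFU : F ⊆ U := fun γ ⟨w, hw, hwz⟩ ↦ ⟨w, hw, hwz.trans_lt hε'.2⟩
      have hUF : {γ : CurveClass ℂ | ∃ w ∈ γ.range, dist w z < ε'} ⊆ F :=
        fun γ ⟨w, hw, hwz⟩ ↦ ⟨w, hw, hwz.le⟩
      have hlimsup := ProbabilityMeasure.limsup_measure_closed_le_of_tendsto htend hFc
      have hev : ∀ᶠ n in atTop, ENNReal.ofReal (c * ε' ^ α) ≤ (P n : Measure (CurveClass ℂ)) F := by
        filter_upwards [hlatt ε' ⟨hε'.1, hε'.2.trans hε.2⟩, hPS hFc.measurableSet] with n hn hnF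
        rw [hnF]
        calc ENNReal.ofReal (c * ε' ^ α)
            ≤ ENNReal.ofReal (μ.real {ω | ∃ w ∈ (X n ω).range, dist w z < ε'}) :=
              ENNReal.ofReal_le_ofReal hn.1
          _ = μ {ω | ∃ w ∈ (X n ω).range, dist w z < ε'} := ofReal_measureReal (measure_ne_top _ _)
          _ ≤ μ {ω | X n ω ∈ F} := measure_mono fun ω hω ↦ hUF hω
      have h1 : ENNReal.ofReal (c * ε' ^ α) ≤ atTop.limsup fun n ↦ (P n : Measure (CurveClass ℂ)) F :=
        le_limsup_of_frequently_le hev.frequently (by isBoundedDefault)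
      have h2 : ENNReal.ofReal (c * ε' ^ α) ≤ ν U :=
        (h1.trans hlimsup).trans (measure_mono hFU)
      rcases le_or_gt (c * ε' ^ α) 0 with h0 | h0
      · exact h0.trans measureReal_nonneg
      · rw [measureReal_def, ← ENNReal.toReal_ofReal h0.le]
        exact ENNReal.toReal_mono (measure_ne_top ν U) h2
    -- let `ε' ↑ ε`
    have hcont : Tendsto (fun ε' : ℝ => c * ε' ^ α) (𝓝[<] ε) (𝓝 (c * ε ^ α)) :=
      ((Real.continuousAt_rpow_const ε α (Or.inl hε.1.ne')).tendsto.const_mul c).mono_left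
        nhdsWithin_le_nhds
    refine le_of_tendsto hcont ?_
    filter_upwards [Ioo_mem_nhdsLT hε.1] with ε' hε' using key ε' hε'
  · -- upper bound: the open event `U`
    have hliminf := ProbabilityMeasure.le_liminf_measure_open_of_tendsto htend hUo
    obtain ⟨n₀, hn₀⟩ := (hlatt ε hε).exists
    have hC : 0 ≤ C * ε ^ α := measureReal_nonneg.trans hn₀.2
    have hev : ∀ᶠ n in atTop, (P n : Measure (CurveClass ℂ)) U ≤ ENNReal.ofReal (C * ε ^ α) := by
      filter_upwards [hlatt ε hε, hPS hUo.measurableSet] with n hn hnU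
      rw [hnU, ← ofReal_measureReal (measure_ne_top _ _)]
      exact ENNReal.ofReal_le_ofReal hn.2
    have h1 : (atTop.liminf fun n ↦ (P n : Measure (CurveClass ℂ)) U) ≤ ENNReal.ofReal (C * ε ^ α) :=
      liminf_le_of_frequently_le hev.frequently (by isBoundedDefault)
    have h2 : ν U ≤ ENNReal.ofReal (C * ε ^ α) := hliminf.trans h1
    exact ENNReal.toReal_le_of_le_ofReal hC h2

/-! ### The registered helper: transfer along clause (iv) -/

/-- **Registered helper `stub_touchExponent_ofLatticeBounds`** (reduction of S3 to the lattice).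
Let `P` be a local Markov chordal family which is the bond-`ℤ²` (`p = ½`) interface scaling limit
along one mesh sequence (clause (iv) of `SymmetryUpgradeR`, unfolded). If for a Dobrushin domain
`D`, an admissible discretisation family `E` of `D`, a point `z`, an exponent `α` and constants
`c, C, ε₀` the lattice touch probabilities satisfy, for every `ε ∈ (0, ε₀)` and all small meshes,
`c ε^α ≤ P_{1/2}[the interface in E_δ comes ε-close to z] ≤ C ε^α`, then
`c ε^α ≤ (P D)[γ comes ε-close to z] ≤ C ε^α` for every `ε ∈ (0, ε₀)` (portmanteau along the mesh
sequence; Billingsley 1999, Thm. 2.1). With `D = 𝔻`, `α = 1/3` and `z` on the lower half circle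
this is exactly the conclusion of `stub_touchExponent`, reduced to its lattice input. -/
theorem stub_touchExponent_ofLatticeBounds : ∀ P : ChordalFamily, IsLocalMarkovChordalFamily P → ((∀ (D : DobrushinDomain) (E : ℝ → DiscreteDobrushin), ZdDiscretisationFamily D E → ∀ᶠ δ in nhdsWithin (0 : ℝ) (Set.Ioi 0), AEMeasurable (bondInterfaceIn D (E δ)) (bondPercolation (zdGraph 2) half)) ∧ ∃ δs : ℕ → ℝ, (∀ n, 0 < δs n) ∧ Tendsto δs atTop (nhds 0) ∧ ∀ (D : DobrushinDomain) (E : ℝ → DiscreteDobrushin), ZdDiscretisationFamily D E → ∀ f : BoundedContinuousFunction (CurveClass ℂ) ℝ, Tendsto (fun n => ∫ ω, f (bondInterfaceIn D (E (δs n)) ω) ∂(bondPercolation (zdGraph 2) half)) atTop (nhds (∫ γ, f γ ∂(P D)))) → ∀ (D : DobrushinDomain) (E : ℝ → DiscreteDobrushin), ZdDiscretisationFamily D E → ∀ (z : ℂ) (α c C ε₀ : ℝ), (∀ ε ∈ Set.Ioo 0 ε₀, ∀ᶠ δ in nhdsWithin (0 : ℝ) (Set.Ioi 0), c * ε ^ α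 ≤ (bondPercolation (zdGraph 2) half).real {ω | ∃ w ∈ (bondInterfaceIn D (E δ) ω).range, dist w z < ε} ∧ (bondPercolation (zdGraph 2) half).real {ω | ∃ w ∈ (bondInterfaceIn D (E δ) ω).range, dist w z < ε} ≤ C * ε ^ α) → ∀ ε ∈ Set.Ioo 0 ε₀, c * ε ^ α ≤ (P D).real {γ | ∃ w ∈ γ.range, dist w z < ε} ∧ (P D).real {γ | ∃ w ∈ γ.range, dist w z < ε} ≤ C * ε ^ α := by
  intro P hP hIV D E hE z α c C ε₀ hlatt
  obtain ⟨hmeas, δs, hpos, hlim, hconv⟩ := hIV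
  haveI : IsProbabilityMeasure (P D) := (hP.isChordal D).1
  -- the mesh sequence tends to `0` within `(0, ∞)`
  have hδs : Tendsto δs atTop (𝓝[>] (0 : ℝ)) :=
    tendsto_nhdsWithin_iff.2 ⟨hlim, Eventually.of_forall fun n ↦ hpos n⟩
  refine stub_touchExponent_portmanteau (bondPercolation (zdGraph 2) half) (P D)
    (fun n ↦ bondInterfaceIn D (E (δs n))) (hδs.eventually (hmeas D E hE)) (hconv D E hE)
    z α c C ε₀ fun ε hε ↦ hδs.eventually (hlatt ε hε)

end Summit.CriticalPhenomena.CardyFormulaZ2.Theorems.SymmetryUpgradeR.SwallowingSkeleton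

end
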